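import Mathlib
import HarnessLib
import Summits.MatrixMultiplication.MatrixMultiplication.Theorems.OutsiderSandwichToricCeilingPowTwoCwBase
import Summits.MatrixMultiplication.MatrixMultiplication.Theorems.OutsiderSandwichToricCeilingPowTwoCwBaseCensusTwoA
import Summits.MatrixMultiplication.MatrixMultiplication.Theorems.OutsiderSandwichToricCeilingPowTwoCwBaseCensusTwoB
import Summits.MatrixMultiplication.MatrixMultiplication.Theorems.OutsiderSandwichToricCeilingPowTwoCwBaseCensusTwoC
import Summits.MatrixMultiplication.MatrixMultiplication.Theorems.OutsiderSandwichToricCeilingPowTwoCwBaseCensusTwoD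

/-!
# OutsiderSandwich — toric ceiling of `cw₂^{⊠N}`: TWO-NESS of the `N = 3` two-cw base and the
ceiling `#Ψ ≤ 3^N − 3` in every frame with at most two cw coordinates, ALL `N ≥ 3`
(decomp-mm lens 4 «minimal-counterexample / extremal reduction», gen 47, kernel K47-8; THESES-FREE,
`ω`-free; helper toward `LaserTangency`, stmt-32268)

LABEL.  TORIC · uniform in `N ≥ 3` · NEC-side instrument; the rates of `h₁ = LaserTangency` are
untouched; nothing here is implied by or implies `ω = 2`.

WHAT.  `…TwoCwBase` (K47-6/7) made the two-cw ceiling unconditional for `N ≥ 4` from the EXISTENCE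
census at `N = 3`.  At `N = 3` itself the argument of `…PowTwoCw` needs TWO distinct perfect
matchings of every lawful co-size-2 complement of `cw ⊠ cw ⊠ D` (and of its two rearrangements);
this file supplies them from the second-certificate census `…TwoCwBaseCensusTwoA–D` (3 510
canonical instances, kernel-decided: the second certificate is `valid` and misses a row of the
first), the first-certificate census `…TwoCwBaseCensusA–D`, and the 48-element symmetry group of
`…TwoCwBase` (`φg`), and concludes:
* `twoCwTwoThree` — every lawful co-size-2 complement of a frame `κ : Fin 3 → Bool` with EXACTLY two
  cw coordinates has two distinct perfect matchings;
* `productFrame_twoCw_three_no_diagonal_comb_degeneration_sub_two` — no diagonal comb degeneration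
  `Ψ` of such a frame has `#Ψ ≥ 25`;
* `productFrame_atMostTwoCw_no_diagonal_comb_degeneration_sub_two_of_three_le` — **for every
  `N ≥ 3` and every basis `κ : Fin N → Bool` with at most two cw coordinates, no diagonal comb
  degeneration `Ψ ⊴ frame κ` has `#Ψ ≥ 3^N − 2`** (`N ≥ 4`: K47-7; `N = 3`: this file for two cw,
  `…PowMixedSubTwo` (K46) for at most one).
So the ≤ 2-cw part of the degeneration-column conjecture of the lens-4 memos is now a THEOREM for
all `N ≥ 3`; what remains DATA / open is ≥ 3 cw coordinates (first instance `cw₂^{⊠3}` itself,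
toric value `∈ [21, 23]`).

CHECKS.  Standard axioms only (the census files use `decide +kernel`); no `native_decide`.
-/

set_option linter.dupNamespace false
set_option maxRecDepth 4000

namespace Summit.MatrixMultiplication.MatrixMultiplication.Theorems.OutsiderSandwichToricCeilingPowTwoCwBaseTwo

open Finset
open Summit.MatrixMultiplication.MatrixMultiplication.Theorems.OutsiderSandwichToricCeilingPowFibres
  (Word Tr3 slotB frame)
open Summit.MatrixMultiplication.MatrixMultiplication.Theorems.OutsiderSandwichToricCeilingPowMixedGlue
open Summit.MatrixMultiplication.MatrixMultiplication.Theorems.OutsiderSandwichToricCeilingPowMixedRules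
open Summit.MatrixMultiplication.MatrixMultiplication.Theorems.OutsiderSandwichToricCeilingPowTransport
open Summit.MatrixMultiplication.MatrixMultiplication.Theorems.OutsiderSandwichToricCeilingPowTwoCwBaseDefs
open Summit.MatrixMultiplication.MatrixMultiplication.Theorems.OutsiderSandwichToricCeilingPowTwoCwBaseCensusA
  (len0 cover0 len1 cover1 len2 cover2)
open Summit.MatrixMultiplication.MatrixMultiplication.Theorems.OutsiderSandwichToricCeilingPowTwoCwBaseCensusB
  (len3 cover3 len4 cover4 len5 cover5)
open Summit.MatrixMultiplication.MatrixMultiplication.Theorems.OutsiderSandwichToricCeilingPowTwoCwBaseCensusC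
  (len6 cover6 len7 cover7 len8 cover8)
open Summit.MatrixMultiplication.MatrixMultiplication.Theorems.OutsiderSandwichToricCeilingPowTwoCwBaseCensusD
  (census9 census10 census11)
open Summit.MatrixMultiplication.MatrixMultiplication.Theorems.OutsiderSandwichToricCeilingPowTwoCwBaseDataTwoA
  (goodD₂)
open Summit.MatrixMultiplication.MatrixMultiplication.Theorems.OutsiderSandwichToricCeilingPowTwoCwBaseCensusTwoA
  (lenb0 cover₂_0 lenb1 cover₂_1 lenb2 cover₂_2)
open Summit.MatrixMultiplication.MatrixMultiplication.Theorems.OutsiderSandwichToricCeilingPowTwoCwBaseCensusTwoB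
  (lenb3 cover₂_3 lenb4 cover₂_4 lenb5 cover₂_5)
open Summit.MatrixMultiplication.MatrixMultiplication.Theorems.OutsiderSandwichToricCeilingPowTwoCwBaseCensusTwoC
  (lenb6 cover₂_6 lenb7 cover₂_7 lenb8 cover₂_8)
open Summit.MatrixMultiplication.MatrixMultiplication.Theorems.OutsiderSandwichToricCeilingPowTwoCwBaseCensusTwoD
  (lenb9 cover₂_9 lenb10 cover₂_10 lenb11 cover₂_11)
open Summit.MatrixMultiplication.MatrixMultiplication.Theorems.OutsiderSandwichToricCeilingPowTwoCwBase
open Summit.MatrixMultiplication.MatrixMultiplication.Theorems.OutsiderSandwichToricCeilingPowTwoCw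
  (productFrame_atMostTwoCw_no_diagonal_comb_degeneration_sub_two)
open Summit.MatrixMultiplication.MatrixMultiplication.Theorems.OutsiderSandwichToricCeilingPowMixedSubTwo
  (productFrame_atMostOneCw_no_diagonal_comb_degeneration_sub_two)
open Summit.MatrixMultiplication.MatrixMultiplication.Theorems.OutsiderSandwichToricCeilingPow
  (productFrame_no_diagonal_comb_degeneration)
open Summit.MatrixMultiplication.MatrixMultiplication.Theorems.OutsiderSandwichToricUniqueness
  (no_comb_degeneration_of_two_matchings)
open Summit.MatrixMultiplication.MatrixMultiplication.Theorems.OutsiderSandwichToricComplement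

/-! ## §1 Indexed extraction from the census files -/

/-- First certificates, chunked groups: the `i`-th certificate is valid for the `i`-th instance. -/
theorem goodD_getElem_of_chunks {Xs : List (W₃ × W₃)} {ds : List ℕ}
    (hcov : ∀ i < ds.length, ∃ lo n, lo ≤ i ∧ i < lo + n ∧
      ((((instOf Xs).zip ds).drop lo).take n).all (fun p => goodD p.1 p.2) = true)
    {i : ℕ} (h₁ : i < (instOf Xs).length) (h₂ : i < ds.length) :
    goodD (instOf Xs)[i] ds[i] = true := by
  obtain ⟨lo, n, hlo, hin, hall⟩ := hcov i h₂
  rw [List.all_eq_true] at hall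
  obtain ⟨j, rfl⟩ := Nat.exists_eq_add_of_le hlo
  have h₃ : j < ((((instOf Xs).zip ds).drop lo).take n).length := by
    simp only [List.length_take, List.length_drop, List.length_zip]; omega
  have hm := List.getElem_mem h₃
  rw [List.getElem_take, List.getElem_drop, List.getElem_zip] at hm
  exact hall _ hm

/-- First certificates, whole groups (`check`). -/
theorem goodD_getElem_of_check {Xs : List (W₃ × W₃)} {ds : List ℕ} (h : check Xs ds = true)
    {i : ℕ} (h₁ : i < (instOf Xs).length) (h₂ : i < ds.length) :
    goodD (instOf Xs)[i] ds[i] = true := by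
  simp only [check, Bool.and_eq_true, decide_eq_true_eq, List.all_eq_true] at h
  have hz : i < ((instOf Xs).zip ds).length := by rw [List.length_zip]; omega
  have hm := List.getElem_mem hz
  rw [List.getElem_zip] at hm
  exact h.2 _ hm

/-- `check` records the length of the certificate list. -/
theorem length_of_check {Xs : List (W₃ × W₃)} {ds : List ℕ} (h : check Xs ds = true) :
    (instOf Xs).length = ds.length := by
  simp only [check, Bool.and_eq_true, decide_eq_true_eq] at h
  exact h.1

/-- Second certificates, chunked groups. -/
theorem goodD₂_getElem_of_chunks {Xs : List (W₃ × W₃)} {ds ds' : List ℕ}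
    (hcov : ∀ i < ds'.length, ∃ lo n, lo ≤ i ∧ i < lo + n ∧
      ((((instOf Xs).zip (ds.zip ds')).drop lo).take n).all
        (fun p => goodD₂ p.1 p.2.1 p.2.2) = true)
    {i : ℕ} (h₁ : i < (instOf Xs).length) (h₂ : i < ds.length) (h₃ : i < ds'.length) :
    goodD₂ (instOf Xs)[i] ds[i] ds'[i] = true := by
  obtain ⟨lo, n, hlo, hin, hall⟩ := hcov i h₃
  rw [List.all_eq_true] at hall
  obtain ⟨j, rfl⟩ := Nat.exists_eq_add_of_le hlo
  have h₄ : j < ((((instOf Xs).zip (ds.zip ds')).drop lo).take n).length := by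
    simp only [List.length_take, List.length_drop, List.length_zip]; omega
  have hm := List.getElem_mem h₄
  rw [List.getElem_take, List.getElem_drop, List.getElem_zip, List.getElem_zip] at hm
  exact hall _ hm

/-- A group with both censuses chunked: every instance has a certified PAIR of certificates. -/
theorem pair_of_chunks {Xs : List (W₃ × W₃)} {ds ds' : List ℕ}
    (hl : (instOf Xs).length = ds.length) (hl' : (instOf Xs).length = ds'.length)
    (hcov : ∀ i < ds.length, ∃ lo n, lo ≤ i ∧ i < lo + n ∧
      ((((instOf Xs).zip ds).drop lo).take n).all (fun p => goodD p.1 p.2) = true)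
    (hcov' : ∀ i < ds'.length, ∃ lo n, lo ≤ i ∧ i < lo + n ∧
      ((((instOf Xs).zip (ds.zip ds')).drop lo).take n).all
        (fun p => goodD₂ p.1 p.2.1 p.2.2) = true) :
    ∀ I ∈ instOf Xs, ∃ n n', goodD I n = true ∧ goodD₂ I n n' = true := by
  intro I hI
  obtain ⟨i, hi, rfl⟩ := List.getElem_of_mem hI
  exact ⟨ds[i]'(by omega), ds'[i]'(by omega), goodD_getElem_of_chunks hcov hi (by omega),
    goodD₂_getElem_of_chunks hcov' hi (by omega) (by omega)⟩

/-- A group with the first census whole and the second chunked. -/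
theorem pair_of_check {Xs : List (W₃ × W₃)} {ds ds' : List ℕ} (hc : check Xs ds = true)
    (hl' : (instOf Xs).length = ds'.length)
    (hcov' : ∀ i < ds'.length, ∃ lo n, lo ≤ i ∧ i < lo + n ∧
      ((((instOf Xs).zip (ds.zip ds')).drop lo).take n).all
        (fun p => goodD₂ p.1 p.2.1 p.2.2) = true) :
    ∀ I ∈ instOf Xs, ∃ n n', goodD I n = true ∧ goodD₂ I n n' = true := by
  have hl := length_of_check hc
  intro I hI
  obtain ⟨i, hi, rfl⟩ := List.getElem_of_mem hI
  exact ⟨ds[i]'(by omega), ds'[i]'(by omega), goodD_getElem_of_check hc hi (by omega),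
    goodD₂_getElem_of_chunks hcov' hi (by omega) (by omega)⟩

/-- THE TWO-NESS CENSUS, assembled: every enumerated instance of every canonical `x`-pair has a
certified pair of certificates. -/
theorem census_all₂ : ∀ X ∈ canonX, ∃ Xs, X ∈ Xs ∧
    ∀ I ∈ instOf Xs, ∃ n n', goodD I n = true ∧ goodD₂ I n n' = true := by
  intro X hX
  rw [canonX_eq] at hX
  simp only [List.mem_append] at hX
  rcases hX with h | h | h | h | h | h | h | h | h | h | h | h
  exacts [⟨_, h, pair_of_chunks len0 lenb0 cover0 cover₂_0⟩,
    ⟨_, h, pair_of_chunks len1 lenb1 cover1 cover₂_1⟩,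
    ⟨_, h, pair_of_chunks len2 lenb2 cover2 cover₂_2⟩,
    ⟨_, h, pair_of_chunks len3 lenb3 cover3 cover₂_3⟩,
    ⟨_, h, pair_of_chunks len4 lenb4 cover4 cover₂_4⟩,
    ⟨_, h, pair_of_chunks len5 lenb5 cover5 cover₂_5⟩,
    ⟨_, h, pair_of_chunks len6 lenb6 cover6 cover₂_6⟩,
    ⟨_, h, pair_of_chunks len7 lenb7 cover7 cover₂_7⟩,
    ⟨_, h, pair_of_chunks len8 lenb8 cover8 cover₂_8⟩,
    ⟨_, h, pair_of_check census9 lenb9 cover₂_9⟩,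
    ⟨_, h, pair_of_check census10 lenb10 cover₂_10⟩,
    ⟨_, h, pair_of_check census11 lenb11 cover₂_11⟩]

/-! ## §2 Distinctness and the core -/

/-- `dec3` is injective. -/
theorem dec3_injective : Function.Injective dec3 := fun t t' e => by
  simp only [dec3, Prod.mk.injEq] at e
  exact Prod.ext (dec_injective e.1) (Prod.ext (dec_injective e.2.1) (dec_injective e.2.2))

/-- A row of the first decoded matching absent from the second makes the decoded finsets differ. -/
theorem toFinset_ne {V : List W₃} {n n' : ℕ}
    (h : ((decodePM V n).any fun t => decide (t ∉ decodePM V n')) = true) :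
    ((decodePM V n).map dec3).toFinset ≠ ((decodePM V n').map dec3).toFinset := by
  rw [List.any_eq_true] at h
  obtain ⟨t, ht, hnot⟩ := h
  rw [decide_eq_true_eq] at hnot
  intro e
  have hmem : dec3 t ∈ ((decodePM V n').map dec3).toFinset := by
    rw [← e, List.mem_toFinset]
    exact List.mem_map.2 ⟨t, ht, rfl⟩
  rw [List.mem_toFinset, List.mem_map] at hmem
  obtain ⟨t', ht', he⟩ := hmem
  exact hnot (dec3_injective he ▸ ht')

/-- CORE: an enumerated lawful instance has two distinct perfect matchings. -/
theorem core₂ {x₁ x₂ y₁ y₂ z₁ z₂ : Word 3} (hX : (enc x₁, enc x₂) ∈ canonX)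
    (hadm : admissible ((enc x₁, enc x₂), (enc y₁, enc y₂), (enc z₁, enc z₂)) = true)
    (hlaw : ∀ i, lawκ (κ₀ i) (x₁ i) (x₂ i) (y₁ i) (y₂ i) (z₁ i) (z₂ i) = true) :
    ∃ P₁ P₂, P₁ ≠ P₂ ∧ isPMκ κ₀ P₁ {x₁, x₂} {y₁, y₂} {z₁, z₂} = true ∧
      isPMκ κ₀ P₂ {x₁, x₂} {y₁, y₂} {z₁, z₂} = true := by
  obtain ⟨Xs, hXs, hgood⟩ := census_all₂ _ hX
  obtain ⟨n, n', hn, hn'⟩ := hgood _ (mem_instOf hXs hadm hlaw)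
  simp only [goodD₂, Bool.and_eq_true] at hn'
  have hadm' := hadm; simp only [admissible, Bool.and_eq_true] at hadm'
  exact ⟨_, _, toFinset_ne hn'.2,
    isPMκ_of_valid (ne_of_lt (canonX_lt _ hX)) (ne_of_lt hadm'.1.1) (ne_of_lt hadm'.1.2) hn,
    isPMκ_of_valid (ne_of_lt (canonX_lt _ hX)) (ne_of_lt hadm'.1.1) (ne_of_lt hadm'.1.2) hn'.1⟩

/-! ## §3 Transport of PAIRS of matchings -/

/-- `map3` of a bijection is injective. -/
theorem map3_injective (φ : Word 3 ≃ Word 3) : Function.Injective (map3 φ) := fun t t' e => by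
  simp only [map3, Prod.mk.injEq] at e
  exact Prod.ext (φ.injective e.1) (Prod.ext (φ.injective e.2.1) (φ.injective e.2.2))

/-- Two-ness transported along a frame-compatible bijection of words. -/
theorem two_transport {κ κ' : Fin 3 → Bool} (φ : Word 3 ≃ Word 3)
    (hφ : ∀ t ∈ frame κ, map3 φ t ∈ frame κ') {x₁ x₂ y₁ y₂ z₁ z₂ : Word 3}
    (h : ∃ P₁ P₂, P₁ ≠ P₂ ∧ isPMκ κ P₁ {x₁, x₂} {y₁, y₂} {z₁, z₂} = true ∧
      isPMκ κ P₂ {x₁, x₂} {y₁, y₂} {z₁, z₂} = true) :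
    ∃ P₁ P₂, P₁ ≠ P₂ ∧ isPMκ κ' P₁ {φ x₁, φ x₂} {φ y₁, φ y₂} {φ z₁, φ z₂} = true ∧
      isPMκ κ' P₂ {φ x₁, φ x₂} {φ y₁, φ y₂} {φ z₁, φ z₂} = true := by
  obtain ⟨P₁, P₂, hne, h₁, h₂⟩ := h
  refine ⟨P₁.image (map3 φ), P₂.image (map3 φ),
    fun e => hne (Finset.image_injective (map3_injective φ) e), ?_, ?_⟩
  · simpa only [image_insert, image_singleton] using isPMκ_transport φ hφ h₁
  · simpa only [image_insert, image_singleton] using isPMκ_transport φ hφ h₂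

/-- Two-ness for `(X, Y, Z)` from two-ness for `(X, Z, Y)`. -/
theorem two_swapYZ {κ : Fin 3 → Bool} {X Y Z : Finset (Word 3)}
    (h : ∃ P₁ P₂, P₁ ≠ P₂ ∧ isPMκ κ P₁ X Z Y = true ∧ isPMκ κ P₂ X Z Y = true) :
    ∃ P₁ P₂, P₁ ≠ P₂ ∧ isPMκ κ P₁ X Y Z = true ∧ isPMκ κ P₂ X Y Z = true := by
  obtain ⟨P₁, P₂, hne, h₁, h₂⟩ := h
  have hinj : Function.Injective (swapYZ (m := 3)) := fun t t' e => by
    simp only [swapYZ, Prod.mk.injEq] at e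
    exact Prod.ext e.1 (Prod.ext e.2.2 e.2.1)
  exact ⟨_, _, fun e => hne (Finset.image_injective hinj e), isPMκ_swapYZ h₁, isPMκ_swapYZ h₂⟩

/-- Two-ness transported along a permutation of the coordinates. -/
theorem two_perm {κ : Fin 3 → Bool} (σ : Equiv.Perm (Fin 3))
    (hκ : ∀ x₁ x₂ y₁ y₂ z₁ z₂ : Word 3, x₁ ≠ x₂ → y₁ ≠ y₂ → z₁ ≠ z₂ →
      (∀ i, lawκ (κ i) (x₁ i) (x₂ i) (y₁ i) (y₂ i) (z₁ i) (z₂ i) = true) →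
      ∃ P₁ P₂, P₁ ≠ P₂ ∧ isPMκ κ P₁ {x₁, x₂} {y₁, y₂} {z₁, z₂} = true ∧
        isPMκ κ P₂ {x₁, x₂} {y₁, y₂} {z₁, z₂} = true)
    (x₁ x₂ y₁ y₂ z₁ z₂ : Word 3) (hx : x₁ ≠ x₂) (hy : y₁ ≠ y₂) (hz : z₁ ≠ z₂)
    (hlaw : ∀ i, lawκ ((κ ∘ σ) i) (x₁ i) (x₂ i) (y₁ i) (y₂ i) (z₁ i) (z₂ i) = true) :
    ∃ P₁ P₂, P₁ ≠ P₂ ∧ isPMκ (κ ∘ σ) P₁ {x₁, x₂} {y₁, y₂} {z₁, z₂} = true ∧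
      isPMκ (κ ∘ σ) P₂ {x₁, x₂} {y₁, y₂} {z₁, z₂} = true := by
  have hne : ∀ {u v : Word 3}, u ≠ v → (permW σ).symm u ≠ (permW σ).symm v :=
    fun h e => h ((permW σ).symm.injective e)
  have h := hκ ((permW σ).symm x₁) ((permW σ).symm x₂) ((permW σ).symm y₁) ((permW σ).symm y₂)
    ((permW σ).symm z₁) ((permW σ).symm z₂) (hne hx) (hne hy) (hne hz) fun i => by
      simp only [permW_symm_apply]
      have h := hlaw (σ.symm i)
      simp only [Function.comp_apply, Equiv.apply_symm_apply] at h
      exact h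
  have h' := two_transport (κ' := κ ∘ σ) (permW σ) (fun t ht => map3_permW_mem σ ht) h
  simpa only [Equiv.apply_symm_apply] using h'

/-! ## §4 The two-ness base -/

/-- CANONICAL CASE: a lawful instance with canonical `x`-pair has two distinct perfect matchings. -/
theorem canonical_case₂ {x₁ x₂ y₁ y₂ z₁ z₂ : Word 3} (hX : (enc x₁, enc x₂) ∈ canonX) (hy : y₁ ≠ y₂)
    (hz : z₁ ≠ z₂) (hlaw : ∀ i, lawκ (κ₀ i) (x₁ i) (x₂ i) (y₁ i) (y₂ i) (z₁ i) (z₂ i) = true) :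
    ∃ P₁ P₂, P₁ ≠ P₂ ∧ isPMκ κ₀ P₁ {x₁, x₂} {y₁, y₂} {z₁, z₂} = true ∧
      isPMκ κ₀ P₂ {x₁, x₂} {y₁, y₂} {z₁, z₂} = true := by
  wlog hyo : ltW (enc y₁) (enc y₂) = true generalizing y₁ y₂
  · rw [pair_comm y₁]
    exact this hy.symm (fun i => lawκ_swap_y _ _ _ _ _ _ _ (hlaw i)) (ltW_swap hy hyo)
  wlog hzo : ltW (enc z₁) (enc z₂) = true generalizing z₁ z₂
  · rw [pair_comm z₁]
    exact this hz.symm (fun i => lawκ_swap_z _ _ _ _ _ _ _ (hlaw i)) (ltW_swap hz hzo)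
  rcases leP_total (enc y₁, enc y₂) (enc z₁, enc z₂) with hle | hle
  · exact core₂ hX (by simp only [admissible, hyo, hzo, hle, Bool.and_self]) hlaw
  · exact two_swapYZ (core₂ hX (by simp only [admissible, hyo, hzo, hle, Bool.and_self])
      fun i => lawκ_swap_yz _ _ _ _ _ _ _ (hlaw i))

/-- **TWO-NESS, frame `cw ⊠ cw ⊠ D` (`N = 3`)**: every lawful co-size-2 complement has two distinct
perfect matchings. -/
theorem ccdBase₂ : ∀ x₁ x₂ y₁ y₂ z₁ z₂ : Word 3, x₁ ≠ x₂ → y₁ ≠ y₂ → z₁ ≠ z₂ →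
    (∀ i, lawκ (κ₀ i) (x₁ i) (x₂ i) (y₁ i) (y₂ i) (z₁ i) (z₂ i) = true) →
    ∃ P₁ P₂, P₁ ≠ P₂ ∧ isPMκ κ₀ P₁ {x₁, x₂} {y₁, y₂} {z₁, z₂} = true ∧
      isPMκ κ₀ P₂ {x₁, x₂} {y₁, y₂} {z₁, z₂} = true := by
  intro x₁ x₂ y₁ y₂ z₁ z₂ hx hy hz hlaw
  obtain ⟨g, hg⟩ := exists_canon (enc x₁) (enc x₂) (enc_ne hx)
  rw [← enc_φg, ← enc_φg] at hg
  have hne : ∀ {u v : Word 3}, u ≠ v → φg g u ≠ φg g v := fun h e => h ((φg g).injective e)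
  have hlaw' := law_φg g hlaw
  have key : ∃ P₁ P₂, P₁ ≠ P₂ ∧
      isPMκ κ₀ P₁ {φg g x₁, φg g x₂} {φg g y₁, φg g y₂} {φg g z₁, φg g z₂} = true ∧
      isPMκ κ₀ P₂ {φg g x₁, φg g x₂} {φg g y₁, φg g y₂} {φg g z₁, φg g z₂} = true := by
    by_cases hxo : ltW (enc (φg g x₁)) (enc (φg g x₂)) = true
    · rw [sortP, if_pos hxo] at hg
      exact canonical_case₂ hg (hne hy) (hne hz) hlaw'
    · rw [sortP, if_neg hxo] at hg
      rw [pair_comm (φg g x₁)]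
      exact canonical_case₂ hg (hne hy) (hne hz) fun i => lawκ_swap_x _ _ _ _ _ _ _ (hlaw' i)
  have h := two_transport (κ := κ₀) (κ' := κ₀) (φg g).symm (fun t ht => map3_φg_symm_mem g ht) key
  simpa only [Equiv.symm_apply_apply] using h

/-- **TWO-NESS OF THE `N = 3` TWO-CW BASE**: for every basis of `Fin 3` with exactly two cw
coordinates, every lawful co-size-2 complement has two distinct perfect matchings. -/
theorem twoCwTwoThree : ∀ κ : Fin 3 → Bool,
    (∀ i j k, κ i = true → κ j = true → κ k = true → i = j ∨ j = k ∨ i = k) →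
    (∃ i j, i ≠ j ∧ κ i = true ∧ κ j = true) →
    ∀ x₁ x₂ y₁ y₂ z₁ z₂ : Word 3, x₁ ≠ x₂ → y₁ ≠ y₂ → z₁ ≠ z₂ →
    (∀ i, lawκ (κ i) (x₁ i) (x₂ i) (y₁ i) (y₂ i) (z₁ i) (z₂ i) = true) →
    ∃ P₁ P₂, P₁ ≠ P₂ ∧ isPMκ κ P₁ {x₁, x₂} {y₁, y₂} {z₁, z₂} = true ∧
      isPMκ κ P₂ {x₁, x₂} {y₁, y₂} {z₁, z₂} = true := by
  intro κ hκ h2 x₁ x₂ y₁ y₂ z₁ z₂ hx hy hz hlaw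
  rcases kappa_two κ hκ h2 with rfl | rfl | rfl
  · exact ccdBase₂ x₁ x₂ y₁ y₂ z₁ z₂ hx hy hz hlaw
  · exact two_perm _ ccdBase₂ _ _ _ _ _ _ hx hy hz hlaw
  · exact two_perm _ ccdBase₂ _ _ _ _ _ _ hx hy hz hlaw

/-! ## §5 The ceilings -/

/-- **`N = 3`, EXACTLY two cw coordinates: no diagonal comb degeneration `Ψ` with `#Ψ ≥ 25`.**
[TORIC · `N = 3` · NEC-side instrument; the argument of `…PowTwoCw` with the two matchings supplied
by `twoCwTwoThree`] -/
theorem productFrame_twoCw_three_no_diagonal_comb_degeneration_sub_two {R : Type*} [CommRing R]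
    [LinearOrder R] [IsStrictOrderedRing R] (κ : Fin 3 → Bool)
    (hκ : ∀ i j k, κ i = true → κ j = true → κ k = true → i = j ∨ j = k ∨ i = k)
    (h2 : ∃ i j, i ≠ j ∧ κ i = true ∧ κ j = true)
    {Ψ : Finset (Tr3 3)} {a b c : Word 3 → R} (hsub : Ψ ⊆ frame κ)
    (hzero : ∀ t ∈ Ψ, a t.1 + b t.2.1 + c t.2.2 = 0)
    (hone : ∀ t ∈ frame κ, t ∉ Ψ → 1 ≤ a t.1 + b t.2.1 + c t.2.2)
    (hdiag : ∀ t ∈ Ψ, ∀ t' ∈ Ψ, (t.1 = t'.1 ∨ t.2.1 = t'.2.1 ∨ t.2.2 = t'.2.2) → t = t')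
    (hbig : 3 ^ 3 ≤ #Ψ + 2) : False := by
  by_cases h1 : 3 ^ 3 ≤ #Ψ + 1
  · exact productFrame_no_diagonal_comb_degeneration (by norm_num) κ hsub hzero hone hdiag h1
  have hcard : #Ψ + 2 = 3 ^ 3 := by omega
  have jΨ₁ : Set.InjOn (fun t : Tr3 3 => t.1) Ψ := fun t ht t' ht' e => hdiag t ht t' ht' (Or.inl e)
  have jΨ₂ : Set.InjOn (fun t : Tr3 3 => t.2.1) Ψ :=
    fun t ht t' ht' e => hdiag t ht t' ht' (Or.inr (Or.inl e))
  have jΨ₃ : Set.InjOn (fun t : Tr3 3 => t.2.2) Ψ :=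
    fun t ht t' ht' e => hdiag t ht t' ht' (Or.inr (Or.inr e))
  obtain ⟨x₁, x₂, hx, hX⟩ := image_eq_sdiff_pair jΨ₁ hcard
  obtain ⟨y₁, y₂, hy, hY⟩ := image_eq_sdiff_pair jΨ₂ hcard
  obtain ⟨z₁, z₂, hz, hZ⟩ := image_eq_sdiff_pair jΨ₃ hcard
  have hlaw : ∀ i, lawκ (κ i) (x₁ i) (x₂ i) (y₁ i) (y₂ i) (z₁ i) (z₂ i) = true := fun i =>
    lawκ_of_counts _ _ _ _ _ _ _
      (fun hi α => two_missing_letters_dcoord κ hsub jΨ₁ jΨ₂ jΨ₃ hx hy hz hX hY hZ i hi α)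
      (fun hi => two_missing_letters_cwcoord κ hsub jΨ₁ jΨ₂ jΨ₃ hx hy hz hX hY hZ i hi)
  obtain ⟨P₁, P₂, hne, h₁, h₂⟩ := twoCwTwoThree κ hκ h2 x₁ x₂ y₁ y₂ z₁ z₂ hx hy hz hlaw
  obtain ⟨f₁, j₁₁, j₁₂, j₁₃, i₁₁, i₁₂, i₁₃⟩ := isPMκ_iff.1 h₁
  obtain ⟨f₂, j₂₁, j₂₂, j₂₃, i₂₁, i₂₂, i₂₃⟩ := isPMκ_iff.1 h₂
  exact no_comb_degeneration_of_two_matchings hne f₁ f₂ j₁₁ j₁₂ j₁₃ j₂₁ j₂₂ j₂₃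
    (i₁₁.trans i₂₁.symm) (i₁₂.trans i₂₂.symm) (i₁₃.trans i₂₃.symm)
    ⟨Ψ, a, b, c, hzero, hone, jΨ₁, jΨ₂, jΨ₃, hX.trans i₁₁.symm, hY.trans i₁₂.symm,
      hZ.trans i₁₃.symm⟩

/-- **`N = 3`, AT MOST two cw coordinates: no diagonal comb degeneration `Ψ` with `#Ψ ≥ 25`.**
(exactly two: the previous theorem; at most one: `…PowMixedSubTwo`, K46.) -/
theorem productFrame_atMostTwoCw_three_no_diagonal_comb_degeneration_sub_two {R : Type*}
    [CommRing R] [LinearOrder R] [IsStrictOrderedRing R] (κ : Fin 3 → Bool)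
    (hκ : ∀ i j k, κ i = true → κ j = true → κ k = true → i = j ∨ j = k ∨ i = k)
    {Ψ : Finset (Tr3 3)} {a b c : Word 3 → R} (hsub : Ψ ⊆ frame κ)
    (hzero : ∀ t ∈ Ψ, a t.1 + b t.2.1 + c t.2.2 = 0)
    (hone : ∀ t ∈ frame κ, t ∉ Ψ → 1 ≤ a t.1 + b t.2.1 + c t.2.2)
    (hdiag : ∀ t ∈ Ψ, ∀ t' ∈ Ψ, (t.1 = t'.1 ∨ t.2.1 = t'.2.1 ∨ t.2.2 = t'.2.2) → t = t')
    (hbig : 3 ^ 3 ≤ #Ψ + 2) : False := by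
  by_cases h2 : ∃ i j, i ≠ j ∧ κ i = true ∧ κ j = true
  · exact productFrame_twoCw_three_no_diagonal_comb_degeneration_sub_two κ hκ h2 hsub hzero hone
      hdiag hbig
  · have hκ₁ : ∀ i j, κ i = true → κ j = true → i = j :=
      fun i j hi hj => by_contra fun hne => h2 ⟨i, j, hne, hi, hj⟩
    exact productFrame_atMostOneCw_no_diagonal_comb_degeneration_sub_two (le_refl 3) κ hκ₁ hsub
      hzero hone hdiag hbig

/-- **TORIC CEILING `⟨3^N − 2⟩` IN EVERY PRODUCT FRAME WITH AT MOST TWO CW COORDINATES, ALL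
`N ≥ 3` — unconditional.**  For every `N ≥ 3` and every basis `κ : Fin N → Bool` with at most two
cw coordinates, no diagonal comb degeneration `Ψ ⊴ frame κ` has `#Ψ ≥ 3^N − 2`; i.e. the
degeneration column of such a frame is at most `3^N − 3`.  (`N ≥ 4`: `…TwoCwBase`, K47-7; `N = 3`:
the previous theorem.)  [TORIC · uniform in `N ≥ 3` · NEC-side instrument; the rates of
`h₁ = LaserTangency` untouched] -/
theorem productFrame_atMostTwoCw_no_diagonal_comb_degeneration_sub_two_of_three_le {R : Type*}
    [CommRing R] [LinearOrder R] [IsStrictOrderedRing R] {N : ℕ} (hN : 3 ≤ N) (κ : Fin N → Bool)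
    (hκ : ∀ i j k, κ i = true → κ j = true → κ k = true → i = j ∨ j = k ∨ i = k)
    {Ψ : Finset (Tr3 N)} {a b c : Word N → R} (hsub : Ψ ⊆ frame κ)
    (hzero : ∀ t ∈ Ψ, a t.1 + b t.2.1 + c t.2.2 = 0)
    (hone : ∀ t ∈ frame κ, t ∉ Ψ → 1 ≤ a t.1 + b t.2.1 + c t.2.2)
    (hdiag : ∀ t ∈ Ψ, ∀ t' ∈ Ψ, (t.1 = t'.1 ∨ t.2.1 = t'.2.1 ∨ t.2.2 = t'.2.2) → t = t')
    (hbig : 3 ^ N ≤ #Ψ + 2) : False := by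
  rcases Nat.lt_or_ge N 4 with h | h
  · obtain rfl : N = 3 := by omega
    exact productFrame_atMostTwoCw_three_no_diagonal_comb_degeneration_sub_two κ hκ hsub hzero hone
      hdiag hbig
  · exact productFrame_atMostTwoCw_no_diagonal_comb_degeneration_sub_two' h κ hκ hsub hzero hone
      hdiag hbig

end Summit.MatrixMultiplication.MatrixMultiplication.Theorems.OutsiderSandwichToricCeilingPowTwoCwBaseTwo
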